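import Summits.ResolutionOfSingularities.ResolutionOfSingularities.Theorems.FrobeniusClosingSteerArithTransportWords
import Summits.ResolutionOfSingularities.ResolutionOfSingularities.Theorems.FrobeniusClosingSteerRegularOrderProduct
import Summits.ResolutionOfSingularities.ResolutionOfSingularities.Theorems.FrobeniusClosingSteerEventuallyConstantReducedOrder
import Literature.AlgebraicGeometry.Resolution.QuasiRegularSequences
import Mathlib.Algebra.CharP.Subring
import HarnessLib

/-!
# Crux `Steer` (stmt-ResolutionOfSingularities-16345), chain W4.1, β-leaf K-β0(b) — STAGE TYPING for the visit induction
# `arithTransport_of_words` (res-L0-w41-plan-1 RULING 299(b); seat res-L0-w41-stub-3 g8)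

OURS (campaign `res-hironaka`, rung L ★L-G4, slot W4.1). Candidates, not facts; nothing here is a statement of H. Hironaka's manuscript
[Hironaka2017] (status: under review). AI-written; AI review is weaker than expert review. Theses-free, definition-free support over
res-L0-w41-strat-2 g4's words `…ArithTransportWords` (p571472) and tri-1's member-datum words `…Words12MemberDatum`.

## What is proved (characteristic `2`, regular local members)
* §1 ALGEBRA (initial forms along a PART of a regular system of parameters, Matsumura 17.10): `eval_not_mem_pow_succ_of_isRsopPart`
  (`Ψ̄ ≠ 0`, `Ψ` a form of degree `d` in an r.s.o.p.-part `z` ⇒ `Ψ(z) ∉ 𝔪^(d+1)`), `eval_mem_pow_of_isRsopPart` (`Ψ(z) ∈ 𝔪^d`), and the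
  ODD-ORDER LEMMA `not_sub_sq_mem_pow_succ_of_cone`: if `f − g² − Ψ(z) ∈ 𝔪^(d+1)` with `d` ODD and `Ψ̄ ≠ 0`, then `f − h² ∉ 𝔪^(d+1)` for EVERY
  `h` (in characteristic `2`, `f − h² ≡ (g − h)² + Ψ(z)`; a square has even initial degree, `Ψ(z)` has initial degree exactly `d`).
* §2 TYPING: an `e = 2` binary cone or an anisotropic cone (`ArithTransport.AnisotropicConeAt`) of odd degree
  `d` forces the EXACT cleaned order `d` (`hasCleanedOrderAt_of_binaryConeE2At`, `hasCleanedOrderAt_of_anisotropicConeAt`); hence W30's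
  `ArithBinaryResidueAt … d i` gives `OddCleanedPointStepAt … i` (`oddCleanedPointStepAt_of_arithBinaryResidueAt` — the `hodd` binder of the hARᵒ
  words from the β-leaf's `ArithSwitchClause` binder); with tri-1's reduced order (hS1b currency): exact odd cleaned order `d` and reduced order
  `d₀` odd ⇒ `d = d₀` and NO odd divisor (`eq_and_noOddDivisorAt_of_hasReducedOrderAt`), an odd divisor ⇒ cleaned order `d₀ + 1`
  (`hasCleanedOrderAt_succ_of_isOddDivisorAt`).
* §3 RUN BOOKKEEPING: the later member of a visit pair starting before a point step `i′` is `≤ i′` (`visitPair_le_of_isPointStep`) and DESCENDING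
  induction over the point steps of `[i₀, i′]` along visit pairs (`desc_pointSteps_of_visitPairs`).
[cite: Matsumura1987, Thm. 17.10] [folklore]
-/

-- `Summit.<S>.<S>.…` duplicates the summit name by design (single-problem summit).
set_option linter.dupNamespace false

open IsLocalRing MvPolynomial
open Literature.AlgebraicGeometry.Resolution
open Summit.ResolutionOfSingularities.ResolutionOfSingularities.Theorems.SwitchingDichotomy.Words

namespace Summit.ResolutionOfSingularities.ResolutionOfSingularities.Theorems.SwitchingDichotomy.ArithTransport

/-! ## §1 Initial forms along a part of a regular system of parameters; the odd-order lemma -/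

section Algebra

variable {S : Type} [CommRing S]

/-- **Initial form along an r.s.o.p.-PART** (Matsumura 17.10 for a sub-polynomial ring of `gr_𝔪 S = κ[T]`): a form `Ψ` of degree `d` in a part
`z` of a regular system of parameters with non-zero reduction `Ψ̄` has `Ψ(z) ∉ 𝔪^(d+1)` (extend `z` to a full regular system and rename).
[cite: Matsumura1987, Thm. 17.10] [folklore] -/
theorem eval_not_mem_pow_succ_of_isRsopPart [IsLocalRing S] {n : ℕ} {z : Fin n → S} (hz : IsRsopPart z) {d : ℕ}
    {Ψ : MvPolynomial (Fin n) S} (hΨ : Ψ.IsHomogeneous d) (h0 : map (residue S) Ψ ≠ 0) :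
    eval z Ψ ∉ maximalIdeal S ^ (d + 1) := by
  haveI := hz.isRegularLocalRing
  obtain ⟨e, x, hfin, hx, hxz⟩ := hz.exists_rsop
  intro hmem
  apply h0
  have hF : (rename (Fin.castAdd e) Ψ).IsHomogeneous d := hΨ.rename_isHomogeneous
  have hcomp : x ∘ Fin.castAdd e = z := funext hxz
  have hev : eval x (rename (Fin.castAdd e) Ψ) = eval z Ψ := by
    rw [eval_rename, hcomp]
  have h := map_residue_eq_zero_of_eval_mem_pow_succ hfin x hx hF (hev ▸ hmem)
  rw [map_rename] at h
  exact rename_injective _ (Fin.castAdd_injective _ _) (by rw [h, map_zero])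

/-- A form of degree `d` in an r.s.o.p.-part evaluates into `𝔪^d`. [folklore] -/
theorem eval_mem_pow_of_isRsopPart [IsLocalRing S] {n : ℕ} {z : Fin n → S} (hz : IsRsopPart z) {d : ℕ}
    {Ψ : MvPolynomial (Fin n) S} (hΨ : Ψ.IsHomogeneous d) : eval z Ψ ∈ maximalIdeal S ^ d :=
  Ideal.pow_right_mono hz.span_range_le_maximalIdeal d (eval_mem_span_pow z hΨ)

/-- **The odd-order lemma** (characteristic `2`): if `f − g² − Ψ(z) ∈ 𝔪^(d+1)` with `d` ODD, `z` an r.s.o.p.-part and `Ψ̄ ≠ 0`, then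
`f − h² ∉ 𝔪^(d+1)` for every `h`: `f − h² ≡ (g − h)² + Ψ(z)`, and `(g − h)²` has order `≥ d + 1` or `≤ d − 1` (even), while `Ψ(z)` has order
exactly `d`. [cite: Matsumura1987, Thm. 17.10] [folklore] -/
theorem not_sub_sq_mem_pow_succ_of_cone [IsRegularLocalRing S] (h2 : (2 : S) = 0) {n : ℕ} {z : Fin n → S}
    (hz : IsRsopPart z) {d : ℕ} (hd : Odd d) {Ψ : MvPolynomial (Fin n) S} (hΨ : Ψ.IsHomogeneous d)
    (h0 : map (residue S) Ψ ≠ 0) {f g : S} (hfg : f - g ^ 2 - eval z Ψ ∈ maximalIdeal S ^ (d + 1)) (h : S) :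
    f - h ^ 2 ∉ maximalIdeal S ^ (d + 1) := by
  intro hh
  obtain ⟨m, rfl⟩ := hd
  have hΨd : eval z Ψ ∈ maximalIdeal S ^ (2 * m + 1) := eval_mem_pow_of_isRsopPart hz hΨ
  have hΨd1 : eval z Ψ ∉ maximalIdeal S ^ (2 * m + 1 + 1) := eval_not_mem_pow_succ_of_isRsopPart hz hΨ h0
  -- `(g − h)² + Ψ(z) ∈ 𝔪^(d+1)`
  have hkey : (g - h) ^ 2 + eval z Ψ ∈ maximalIdeal S ^ (2 * m + 1 + 1) := by
    have e : (g - h) ^ 2 + eval z Ψ = (f - h ^ 2) - (f - g ^ 2 - eval z Ψ) - 2 * (h * (g - h)) := by ring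
    rw [e, h2, zero_mul, sub_zero]
    exact sub_mem hh hfg
  by_cases ha : g - h ∈ maximalIdeal S ^ (m + 1)
  · -- deep square: `(g − h)² ∈ 𝔪^(d+1)`, so `Ψ(z) ∈ 𝔪^(d+1)`
    have ha2 : (g - h) ^ 2 ∈ maximalIdeal S ^ (2 * m + 1 + 1) := by
      rw [show 2 * m + 1 + 1 = (m + 1) + (m + 1) by ring, pow_add, sq]
      exact Ideal.mul_mem_mul ha ha
    apply hΨd1
    have e : eval z Ψ = ((g - h) ^ 2 + eval z Ψ) - (g - h) ^ 2 := by ring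
    rw [e]
    exact sub_mem hkey ha2
  · -- shallow square: `(g − h)² ∉ 𝔪^d`, while `Ψ(z) ∈ 𝔪^d`
    have ha2 : (g - h) ^ 2 ∉ maximalIdeal S ^ (2 * (m + 1) - 1) :=
      RegularOrder.not_sq_mem_pow_of_not_mem_pow (by omega) ha
    rw [show 2 * (m + 1) - 1 = 2 * m + 1 by omega] at ha2
    apply ha2
    have e : (g - h) ^ 2 = ((g - h) ^ 2 + eval z Ψ) - eval z Ψ := by ring
    rw [e]
    exact sub_mem (Ideal.pow_le_pow_right (Nat.le_succ _) hkey) hΨd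

/-- An `e = 2` reduction is non-zero (`0 = C 0 · ℓ^d`). [folklore] -/
theorem map_residue_ne_zero_of_e2 [IsLocalRing S] {d : ℕ} {Ψ : MvPolynomial (Fin 2) S}
    (hE : ¬ ∃ a b c : ResidueField S, map (residue S) Ψ = C c * (C a * X 0 + C b * X 1) ^ d) :
    map (residue S) Ψ ≠ 0 :=
  fun h0 => hE ⟨0, 0, 0, by rw [h0, C_0, zero_mul]⟩

/-- An anisotropic reduction is non-zero (it does not vanish at `(1, 0)`). [folklore] -/
theorem map_residue_ne_zero_of_anisotropic [IsLocalRing S] {Ψ : MvPolynomial (Fin 2) S}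
    (hA : ∀ a b : ResidueField S, (a ≠ 0 ∨ b ≠ 0) → eval ![a, b] (map (residue S) Ψ) ≠ 0) :
    map (residue S) Ψ ≠ 0 :=
  fun h0 => hA 1 0 (Or.inl one_ne_zero) (by rw [h0, map_zero])

end Algebra

/-! ## §2 Typing: cones of odd degree fix the cleaned order; interaction with the reduced order -/

section Typing

variable {K : Type} [Field K]

variable [CharP K 2]

/-- **A cone of odd degree `d` with `Ψ̄ ≠ 0` fixes the cleaned order at EXACTLY `d`** (regular member, characteristic `2`). [folklore] -/
theorem hasCleanedOrderAt_of_cone {R : ℕ → Subring K} {s : ℕ → K} {d j : ℕ} (hreg : IsRegularLocalRing (R j)) (hd : Odd d)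
    [hloc : IsLocalRing (R j)] (hs : s j ^ 2 ∈ R j) {g m₁ m₂ : R j} {Ψ : MvPolynomial (Fin 2) (R j)}
    (hm : IsRsopPart ![m₁, m₂]) (hΨ : Ψ.IsHomogeneous d)
    (hcong : (⟨s j ^ 2, hs⟩ : R j) - g ^ 2 - MvPolynomial.eval ![m₁, m₂] Ψ ∈ maximalIdeal (R j) ^ (d + 1))
    (h0 : MvPolynomial.map (residue (R j)) Ψ ≠ 0) : HasCleanedOrderAt R s 2 j d := by
  haveI := hreg
  refine ⟨hloc, hs, ⟨g, ?_⟩, fun h => not_sub_sq_mem_pow_succ_of_cone (CharTwo.two_eq_zero) hm hd hΨ h0 hcong h⟩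
  have e : (⟨s j ^ 2, hs⟩ : R j) - g ^ 2 =
      ((⟨s j ^ 2, hs⟩ : R j) - g ^ 2 - MvPolynomial.eval ![m₁, m₂] Ψ) + MvPolynomial.eval ![m₁, m₂] Ψ := by ring
  rw [e]
  exact add_mem (Ideal.pow_le_pow_right (Nat.le_succ d) hcong) (eval_mem_pow_of_isRsopPart hm hΨ)

/-- An `e = 2` binary cone of odd degree `d` ⇒ cleaned order exactly `d`. [folklore] -/
theorem hasCleanedOrderAt_of_binaryConeE2At {R : ℕ → Subring K} {s : ℕ → K} {d j : ℕ} (hreg : IsRegularLocalRing (R j))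
    (hd : Odd d) (h : BinaryConeE2At R s 2 d j) : HasCleanedOrderAt R s 2 j d := by
  obtain ⟨hloc, hs, g, m₁, m₂, Ψ, hm, hΨ, hcong, hE⟩ := h
  exact hasCleanedOrderAt_of_cone hreg hd hs hm hΨ hcong (map_residue_ne_zero_of_e2 hE)

/-- An anisotropic binary cone of odd degree `d` ⇒ cleaned order exactly `d`. [folklore] -/
theorem hasCleanedOrderAt_of_anisotropicConeAt {R : ℕ → Subring K} {s : ℕ → K} {d j : ℕ} (hreg : IsRegularLocalRing (R j))
    (hd : Odd d) (h : AnisotropicConeAt R s 2 d j) : HasCleanedOrderAt R s 2 j d := by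
  obtain ⟨hloc, hs, g, m₁, m₂, Ψ, hm, hΨ, hcong, hA⟩ := h
  exact hasCleanedOrderAt_of_cone hreg hd hs hm hΨ hcong (map_residue_ne_zero_of_anisotropic hA)

/-- **`hodd` from the switch clause**: W30's arithmetic binary residue of odd degree `d` at `i` makes `i` an odd-cleaned point step. [folklore] -/
theorem oddCleanedPointStepAt_of_arithBinaryResidueAt {R : ℕ → Subring K} {P : (i : ℕ) → Ideal (R i)} {s : ℕ → K} {d i : ℕ}
    (hreg : IsRegularLocalRing (R i)) (hd : Odd d) (h : ArithBinaryResidueAt R P s 2 d i) :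
    OddCleanedPointStepAt R P s 2 i := by
  obtain ⟨hpt, hA⟩ := (arithBinaryResidueAt_iff R P s 2 d i).mp h
  obtain ⟨hloc, hs, hex, hexact⟩ := hasCleanedOrderAt_of_anisotropicConeAt hreg hd hA
  exact ⟨hpt, hloc, hs, d, hd, hex, hexact⟩

omit [CharP K 2] in
/-- Exact odd cleaned order `d` and odd reduced order `d₀` at the same stage ⇒ `d = d₀` and there is NO odd divisor (A-type). [folklore] -/
theorem eq_and_noOddDivisorAt_of_hasReducedOrderAt {R : ℕ → Subring K} {s : ℕ → K} {i d d₀ : ℕ} (hd : Odd d) (hd₀ : Odd d₀)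
    (hcl : HasCleanedOrderAt R s 2 i d) (hred : HasReducedOrderAt R s 2 i d₀) : d = d₀ ∧ NoOddDivisorAt R s 2 i := by
  obtain ⟨ν, hν, hcase⟩ := hred
  have hνd : ν = d := ReducedOrderAssembly.cleanedOrder_unique hν hcl
  rcases hcase with ⟨hno, h⟩ | ⟨-, h⟩
  · exact ⟨by omega, hno⟩
  · exfalso
    obtain ⟨a, rfl⟩ := hd
    obtain ⟨b, rfl⟩ := hd₀
    omega

omit [CharP K 2] in
/-- Reduced order `d₀` and an odd divisor at the same stage ⇒ cleaned order `d₀ + 1` (B-type). [folklore] -/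
theorem hasCleanedOrderAt_succ_of_isOddDivisorAt {R : ℕ → Subring K} {s : ℕ → K} {i d₀ : ℕ} {x : K}
    (hred : HasReducedOrderAt R s 2 i d₀) (hx : IsOddDivisorAt R s 2 i x) : HasCleanedOrderAt R s 2 i (d₀ + 1) := by
  obtain ⟨ν, hν, hcase⟩ := hred
  rcases hcase with ⟨hno, -⟩ | ⟨-, h⟩
  · exact absurd hx (hno x)
  · rwa [h]

end Typing

/-! ## §3 Run bookkeeping: descending induction over the point steps of an interval -/

section Run

variable {K : Type} [Field K]

/-- The later member of a visit pair starting strictly before a point step `i′` is `≤ i′`. [folklore] -/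
theorem visitPair_le_of_isPointStep {R : ℕ → Subring K} {P : (i : ℕ) → Ideal (R i)} {j j' i' : ℕ} (hv : IsVisitPair R P j j')
    (hji' : j < i') (hpt : IsPointStep R P i') : j' ≤ i' := by
  by_contra h
  exact hv.2.2.2 i' hji' (by omega) hpt

/-- **Descending induction along visit pairs**: a property holding at a point step `i′` and pulled back along every visit pair `(j, j′)` with
`i₀ ≤ j`, `j′ ≤ i′` holds at every point step of `[i₀, i′]`. [folklore] -/
theorem desc_pointSteps_of_visitPairs (R : ℕ → Subring K) (P : (i : ℕ) → Ideal (R i))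
    (hrec : ∀ i₀ : ℕ, ∃ i, i₀ ≤ i ∧ IsPointStep R P i) (Q : ℕ → Prop) {i₀ i' : ℕ} (hpt' : IsPointStep R P i') (hQ' : Q i')
    (hstep : ∀ j j', i₀ ≤ j → j' ≤ i' → IsVisitPair R P j j' → Q j' → Q j) :
    ∀ j, i₀ ≤ j → j ≤ i' → IsPointStep R P j → Q j := by
  suffices h : ∀ n j, i' - j ≤ n → i₀ ≤ j → j ≤ i' → IsPointStep R P j → Q j from
    fun j h₀ hle hpt => h (i' - j) j le_rfl h₀ hle hpt
  intro n
  induction n with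
  | zero =>
    intro j hn _ hle _
    obtain rfl : j = i' := by omega
    exact hQ'
  | succ n ih =>
    intro j hn h₀ hle hpt
    rcases eq_or_lt_of_le hle with rfl | hlt
    · exact hQ'
    obtain ⟨j', hv⟩ := VisitSequence.exists_isVisitPair_of_pointStep R P hrec hpt
    have hj' : j' ≤ i' := visitPair_le_of_isPointStep hv hlt hpt'
    have hjj' : j < j' := hv.1
    exact hstep j j' h₀ hj' hv (ih j' (by omega) (by omega) hj' hv.2.2.1)

end Run

end Summit.ResolutionOfSingularities.ResolutionOfSingularities.Theorems.SwitchingDichotomy.ArithTransport
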